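import Summits.CriticalPhenomena.PercolationContinuityZ3.Theorems.PercNearOneGluingNoHeavyLowerTailIncStarStrongInduction
import HarnessLib

/-!
# The increasing star from two RATIO inequalities between the Bernstein coefficients along a root pair

Support file for the Sahi programme (`--supports stmt-CriticalPhenomena-4575`, prover prim-sahi-p2 gen 30).  No definitions, no named facts, no
sorries; standard axioms.  Memo `run/shared/lean/prim/prim-sahi/FROM-prim-sahi-p2-gen30-VERTEX-INDUCTION-LIGHT-STEP.md` §10, `prim-sahi-p2/PROOF-E3.md` §40.

Along a root pair `e = s(s,z)` of weight `p`, Sahi's cubic of the increasing star is the Bernstein cubic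
`E₃(P_w) = (1−p)³c₀ + 3p(1−p)²c₁ + 3p²(1−p)c₂ + p³c₃` with `c₀ = E₃(P_{w[e↦0]})`, `c₁ = polar₁(P_{w[e↦0]}, P_{w[e↦1]})`,
`c₂ = polar₁(P_{w[e↦1]}, P_{w[e↦0]})`, `c₃ = E₃(P_{w[e↦1]})` (`EdgeInduction.sahiE3_oneBond`).  Gen 5 reduced the star to hRZ: `c₁ ≥ 0 ∧ c₂ ≥ 0` along
fractional root–unmarked pairs (`IncStar.incStar_nonneg_of_rootUnmarkedBernsteinStrongIH`).  The census of root pairs (prim-sahi-census W145,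
19.76·10⁹ exact root pairs, 0 exceptions) records the RATIO inequality `2c₁ ≥ c₂` (its 'P2'), and gen 30's fibre calculus suggests the companion
`3c₂ ≥ 2c₃` (the 'upgrade' inequalities `RF_κ ≥ ½RF_{κ[z→2]}`, `RF_κ ≥ 2RF_{κ[z→3]}` of the root-fibre calculus summed over the other root
edges; 0 exceptions in gen 30's exact tests on ≈ 3 000 root pairs including the W145 witness supports RZW(k), W2(k), RS-9, KC6).  Since `c₃ = E₃(P_{w[e↦1]})` is an increasing star with one fractional pair fewer, the two ratio
inequalities give `c₂ ≥ ⅔c₃ ≥ 0` and `c₁ ≥ ½c₂ ≥ 0`, i.e. hRZ, inside the induction.  (Both ratio inequalities are 'dark': not certifiable from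
Harris⊗states + van den Berg–Kahn + stars + REB rows in the width-2 port/target algebra, kit j289706.)  **`incStar_nonneg_of_bernsteinRatio`: if along every
fractional root–unmarked pair `3c₂ ≥ 2c₃` and `2c₁ ≥ c₂` (the step may use the increasing star for every weight with fewer fractional non-loop pairs
and every marking), then the increasing star holds on every finite weighted graph.**  Nothing here asserts the two ratio inequalities.
-/

noncomputable section

namespace Summit.CriticalPhenomena.PercolationContinuityZ3.Theorems

namespace IncStar

open MeasureTheory Set Literature.Probability.Percolation Literature.Probability.LatticeModels EdgeInduction
open scoped Classical

variable {n : ℕ}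

/-- Bernstein positivity from the ratio chain: `c₃ ≥ 0`, `3c₂ ≥ 2c₃`, `2c₁ ≥ c₂` give `c₁ ≥ 0 ∧ c₂ ≥ 0`. [folklore] -/
theorem bernstein_nonneg_of_ratio {c₁ c₂ c₃ : ℝ} (h3 : 0 ≤ c₃) (h23 : 2 * c₃ ≤ 3 * c₂) (h12 : c₂ ≤ 2 * c₁) :
    0 ≤ c₁ ∧ 0 ≤ c₂ := by
  constructor <;> linarith

/-- **THE INCREASING STAR FROM THE TWO BERNSTEIN-RATIO INEQUALITIES ALONG ROOT PAIRS.**  Suppose that for every weight `w`, all markings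
`s b c y`, every unmarked `z ∉ {s,b,c,y}` with `e = s(s,z)` fractional, and GIVEN the increasing star for every weight with fewer fractional non-loop
pairs and every marking, the Bernstein coefficients of the increasing star along `e` satisfy `3c₂ ≥ 2c₃` and `2c₁ ≥ c₂`
(`c₁ = polar₁(P_{w[e↦0]}, P_{w[e↦1]})`, `c₂ = polar₁(P_{w[e↦1]}, P_{w[e↦0]})`, `c₃ = E₃(P_{w[e↦1]})`).  Then `E₃({s↔b},{s↔c},{s↔y}) ≥ 0` under
`prodBernoulli w` for every weight `w` on the pairs of `Fin n` and all `s b c y`.  (Gen 5's root-edge schema; the root–TARGET pairs are theorems,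
`IncStar.rootTarget_polar_nonneg`.) [this work] -/
theorem incStar_nonneg_of_bernsteinRatio
    (hR : ∀ (w : Sym2 (Fin n) → unitInterval) (s b c y z : Fin n), z ≠ s → z ≠ b → z ≠ c → z ≠ y → s(s, z) ∈ fracEdges w →
      (∀ w' : Sym2 (Fin n) → unitInterval,
          ((fracEdges w').filter fun f => ¬ f.IsDiag).card < ((fracEdges w).filter fun f => ¬ f.IsDiag).card →
          ∀ s' b' c' y' : Fin n, 0 ≤ sahiE3 (prodBernoulli w') (openConn s' b') (openConn s' c') (openConn s' y')) →
      2 * sahiE3 (prodBernoulli (Function.update w s(s, z) 1)) (openConn s b) (openConn s c) (openConn s y) ≤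
          3 * polar₁ (prodBernoulli (Function.update w s(s, z) 1)) (prodBernoulli (Function.update w s(s, z) 0))
            (openConn s b) (openConn s c) (openConn s y) ∧
        polar₁ (prodBernoulli (Function.update w s(s, z) 1)) (prodBernoulli (Function.update w s(s, z) 0))
            (openConn s b) (openConn s c) (openConn s y) ≤
          2 * polar₁ (prodBernoulli (Function.update w s(s, z) 0)) (prodBernoulli (Function.update w s(s, z) 1))
            (openConn s b) (openConn s c) (openConn s y)) :
    ∀ (w : Sym2 (Fin n) → unitInterval) (s b c y : Fin n),
      0 ≤ sahiE3 (prodBernoulli w) (openConn s b) (openConn s c) (openConn s y) := by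
  refine incStar_nonneg_of_rootUnmarkedBernsteinStrongIH ?_
  intro w s b c y z hzs hzb hzc hzy he IH
  have hnd : ¬ (s(s, z) : Sym2 (Fin n)).IsDiag := by rw [Sym2.mk_isDiag_iff]; exact hzs.symm
  have h3 : 0 ≤ sahiE3 (prodBernoulli (Function.update w s(s, z) 1)) (openConn s b) (openConn s c) (openConn s y) :=
    IH _ (card_fracEdges_update_lt w he hnd 1 (Or.inr rfl)) s b c y
  obtain ⟨h23, h12⟩ := hR w s b c y z hzs hzb hzc hzy he IH
  obtain ⟨h1, h2⟩ := bernstein_nonneg_of_ratio h3 h23 h12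
  exact ⟨h1, h2⟩

/-- The same reduction with the ratio inequalities assumed outright (no induction hypothesis handed to the step). [this work] -/
theorem incStar_nonneg_of_bernsteinRatio'
    (hR : ∀ (w : Sym2 (Fin n) → unitInterval) (s b c y z : Fin n), z ≠ s → z ≠ b → z ≠ c → z ≠ y → s(s, z) ∈ fracEdges w →
      2 * sahiE3 (prodBernoulli (Function.update w s(s, z) 1)) (openConn s b) (openConn s c) (openConn s y) ≤
          3 * polar₁ (prodBernoulli (Function.update w s(s, z) 1)) (prodBernoulli (Function.update w s(s, z) 0))
            (openConn s b) (openConn s c) (openConn s y) ∧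
        polar₁ (prodBernoulli (Function.update w s(s, z) 1)) (prodBernoulli (Function.update w s(s, z) 0))
            (openConn s b) (openConn s c) (openConn s y) ≤
          2 * polar₁ (prodBernoulli (Function.update w s(s, z) 0)) (prodBernoulli (Function.update w s(s, z) 1))
            (openConn s b) (openConn s c) (openConn s y)) :
    ∀ (w : Sym2 (Fin n) → unitInterval) (s b c y : Fin n),
      0 ≤ sahiE3 (prodBernoulli w) (openConn s b) (openConn s c) (openConn s y) :=
  incStar_nonneg_of_bernsteinRatio fun w s b c y z hzs hzb hzc hzy he _ => hR w s b c y z hzs hzb hzc hzy he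

/-! ### Appendix (gen 30, later the same session): the ratio inequalities imply the chord through the origin -/

/-- **Cubic chord from the ratio chain.**  For a Bernstein cubic `f(p) = (1−p)³c₀ + 3p(1−p)²c₁ + 3p²(1−p)c₂ + p³c₃` with `c₀ ≥ 0`, `3c₂ ≥ 2c₃` and
`2c₁ ≥ c₂`: `p·c₃ ≤ f(p)` on `[0,1]`, since `f(p) − p c₃ = (1−p)[(1−p)²c₀ + p(1−p)(3c₁ − c₃) + p²(3c₂ − 2c₃)]`. [this work] -/
theorem bernstein_chord_of_ratio {p c₀ c₁ c₂ c₃ : ℝ} (hp0 : 0 ≤ p) (hp1 : p ≤ 1) (h0 : 0 ≤ c₀) (h23 : 2 * c₃ ≤ 3 * c₂)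
    (h12 : c₂ ≤ 2 * c₁) :
    p * c₃ ≤ (1 - p) ^ 3 * c₀ + 3 * p * (1 - p) ^ 2 * c₁ + 3 * p ^ 2 * (1 - p) * c₂ + p ^ 3 * c₃ := by
  have key : (1 - p) ^ 3 * c₀ + 3 * p * (1 - p) ^ 2 * c₁ + 3 * p ^ 2 * (1 - p) * c₂ + p ^ 3 * c₃ - p * c₃
      = (1 - p) * ((1 - p) ^ 2 * c₀ + p * (1 - p) * (3 * c₁ - c₃) + p ^ 2 * (3 * c₂ - 2 * c₃)) := by ring
  have hq : 0 ≤ 1 - p := sub_nonneg.2 hp1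
  have h13 : 0 ≤ 3 * c₁ - c₃ := by linarith
  have h23' : 0 ≤ 3 * c₂ - 2 * c₃ := by linarith
  have hsum : 0 ≤ (1 - p) ^ 2 * c₀ + p * (1 - p) * (3 * c₁ - c₃) + p ^ 2 * (3 * c₂ - 2 * c₃) := by positivity
  nlinarith [mul_nonneg hq hsum, key]

/-- **The ratio inequalities along a pair give the chord through the origin (CO).**  For any weight `w`, pair `e` and events `A, B, C`: if
`E₃(P_{w[e↦0]}) ≥ 0`, `3·polar₁(P¹,P⁰) ≥ 2·E₃(P¹)` and `2·polar₁(P⁰,P¹) ≥ polar₁(P¹,P⁰)`, then `w(e)·E₃(P_{w[e↦1]}) ≤ E₃(P_w)`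
(`EdgeInduction.sahiE3_oneBond` + `bernstein_chord_of_ratio`).  So the hypothesis of `incStar_nonneg_of_bernsteinRatio` implies that of
`IncStar.incStar_nonneg_of_contractionChord`. [this work] -/
theorem contractionChord_of_bernsteinRatio (w : Sym2 (Fin n) → unitInterval) (e : Sym2 (Fin n)) (A B C : Set (BondConfig (Fin n)))
    (h0 : 0 ≤ sahiE3 (prodBernoulli (Function.update w e 0)) A B C)
    (h23 : 2 * sahiE3 (prodBernoulli (Function.update w e 1)) A B C ≤
      3 * polar₁ (prodBernoulli (Function.update w e 1)) (prodBernoulli (Function.update w e 0)) A B C)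
    (h12 : polar₁ (prodBernoulli (Function.update w e 1)) (prodBernoulli (Function.update w e 0)) A B C ≤
      2 * polar₁ (prodBernoulli (Function.update w e 0)) (prodBernoulli (Function.update w e 1)) A B C) :
    (w e : ℝ) * sahiE3 (prodBernoulli (Function.update w e 1)) A B C ≤ sahiE3 (prodBernoulli w) A B C := by
  rw [sahiE3_oneBond w e A B C]
  exact bernstein_chord_of_ratio (w e).2.1 (w e).2.2 h0 h23 h12

end IncStar

end Summit.CriticalPhenomena.PercolationContinuityZ3.Theorems

end
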